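import Summits.BirchSwinnertonDyer.BirchSwinnertonDyer.Theorems.SignedLowerHalvesKobayashiLowerHalfLargeImageKuriharaRigidityThm74
import Summits.BirchSwinnertonDyer.Rank1Residual.Supersingular.KobayashiMainConjectureKuriharaRigidity
import Literature.NumberTheory.EllipticCurves.KatoRankBoundProofs
import Literature.NumberTheory.EllipticCurves.CuspFormLFunctionLevelConductorProofs
import HarnessLib

/-!
# Kobayashi 2003 Thm. 7.4, the CONVERSE direction AT THE TRIVIAL CHARACTER, IN THE KERNEL: ONE signed main
# conjecture `KobayashiMainConjecture W p ε` gives Kato's main identity read on the sign-`ε` `η = 1`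
# Coleman/Kato package — and with it the lead's converse binder
# `Kobayashi74_CastellaSano2026_kimTamagawaDefect_of_signedMC_OPEN` DERIVED from Castella–Sano Thm. 1
# (ii) ⟹ (i) ALONE (route `SignedLowerHalves`, crux `KobayashiLowerHalfLargeImage` = item
# stmt-BirchSwinnertonDyer-19001, line `kurihara_rigidity`; cell `bsd-ssimc`, seat `bsd-line-slh-p1-w2` g2;
# a `--supports … --as helper` file)

WHAT. The sibling `…KuriharaRigidityThm74` (p607446, this seat g0) proved Kobayashi's Thm. 7.4 (ii) «Kato's
main conjecture ⟹ the signed main conjecture of sign `ε`» at `η = 1` in the kernel, on the ACCEPTED package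
`Kobayashi2003.SignedColemanKatoData` (Thm. 6.2 (6.13)/(6.14) + Thm. 6.3 + Thm. 7.3 i) (7.21) + Kato Thm.
12.6), and with it DERIVED the lead's two forward binders. The lead's last cycle (p609053) then typed the
CONVERSE composite binder `Kobayashi74_CastellaSano2026_kimTamagawaDefect_of_signedMC_OPEN` («a signed main
conjecture for ONE sign ⟹ Kim's Conjecture 1.10 at the pair» = Kobayashi Thm. 7.4 «even MC ⟹ Kato's MC» /
«odd MC ⟹ Kato's MC» ∘ Castella–Sano Thm. 1 (ii) ⟹ (i)), consumed by the EQUIVALENCE file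
`…KuriharaRigidityEquivalence` (p609449: crux 3 on X7 ∧ ¬CM ∧ Surj ∧ p ≥ 5 ⟺ Kim's Conjecture 1.10 there) —
with Kobayashi's theorem again ON FAITH inside the composite. THIS FILE runs that direction of Thm. 7.4 in the
kernel too ("By Theorem 6.2, 6.3 and (7.21), we have three exact sequences … The theorem follows from these
sequences", p. 13): along `0 → 𝐇¹/Z → Λ/col(Z) → X^ε → X₀ → 0` (sibling, `exists_fourTermExact_…`),
multiplicativity of characteristic ideals gives `char(𝐇¹/Z) · char X^ε = char(Λ/col Z) · char X₀` with
`char(Λ/col Z) = (ϖ·L_p^ε)` (Thm. 6.3 on ideals, sibling); the signed main conjecture `char X^ε = (ϖ·L_p^ε)`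
(the tree's `KobayashiMainConjecture W p ε`, which also carries `X^ε` torsion = Thm. 1.2's content) lets
the non-zero principal factor cancel (`Ideal.span_singleton_mul_right_inj`, `Λ` a domain, every `char` over
`Λ` principal — `charIdeal_isPrincipal_holds`): `char X₀ = char(𝐇¹/Z)`, Kato's main identity on the data.

* §1 `Λ`-ALGEBRA [folklore]: the two product identities along `0 → A → Q → X → B → 0` exposing the image
  `Q'` of `Q → X` (the sibling's `charIdeal_eq_of_fourTermExact` keeps them internal).
* §2 the sibling's data assembly with Kobayashi Thm. 1.2 REPLACED by a torsion hypothesis on `X^ε` and the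
  period-unit fact replaced by `ord_p ϖ = 0` for the given frame (so the converse theorem needs neither named
  fact) — `fourTerm_data_of_signedColemanKato_of_isTorsion`; and the converse theorem
  `katoMainIdentity_of_kobayashiMainConjecture`: ANY odd good `p` with `a_p = 0`, `E[p]` irreducible.
* §3 the lead's converse binder from FINER inputs, displayed-frame form
  (`kobayashi74_castellaSano2026_kimTamagawaDefect_of_signedMC_OPEN_of_katoFrame`): hypothesis `hCSc` = the body
  of the NEW Literature statement `CastellaSano2026.thm1_kimTamagawaDefect_of_katoMainIdentity_OPEN` (Castella–
  Sano arXiv:2601.14504 Thm. 1 (ii) ⟹ (i) read on the sign-`ε` package, PREPRINT claim, proposed with this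
  file), plus three PUBLISHED construction/existence facts by name — the package `thm62_63_73_signedColemanKato_zeta`
  (Kobayashi Thm. 6.2/6.3/7.3 i) + Kato 12.6), Pollack's pair `pollack_exists_plusMinusPAdicLFunction`, and
  modularity `exists_isNewformOf` (to pin the level of the binder's newform to `N_E`, Atkin–Lehner strong
  multiplicity one `IsNewformOf.level_eq_level`).

TRUST BASE of the lead's EQUIVALENCE after this file (numbers, not adjectives): the converse direction ⟸ {CS Thm
1 (ii) ⟹ (i) on the package [PREPRINT claim], package construction fact, Pollack's theorem, modularity,
Kobayashi Thm. 4.1, 1.2, the period facts} — Kobayashi Thm. 7.4 is nowhere on faith on line `kurihara_rigidity`.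
HONEST FRAMING (cell `bsd-ssimc`, HOME `run/shared/lean/pub/bsd-ssimc/`; D-0036/D-0074): TOOL THEOREMS ONLY — no
definition, no named fact minted, no `sorry`, axioms standard; CONDITIONAL on the displayed hypotheses; the
class-wide crux, the line's hard stub (Kim's Conjecture 1.10 on X7) and the route are NOT closed; nothing is
booked; BSD is not proved by any of this. `--supports stmt-BirchSwinnertonDyer-19001 --as helper`.

References: [Kobayashi2003] Thm. 1.2, §4–§5, Thm. 6.2/6.3, Prop. 7.1, Thm. 7.3 (7.21), Thm. 7.4 and its proof
(p. 13); [Kato2004Asterisque] §12.2, Thm. 12.4–12.6, Conj. 12.10; [CastellaSano2026] Thm. 1, Prop. 2.2.3, §2.4;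
[Pollack2003] Cor. 5.11, Prop. 6.18; [AtkinLehner1970] Thm. 4; [NeukirchSchmidtWingberg2008] Ch. V §3.
-/

set_option autoImplicit false
-- single-problem summit (D-0017): the doubled namespace component is by design
set_option linter.dupNamespace false

noncomputable section

open scoped Classical MatrixGroups ModularForm

open CongruenceSubgroup Field WeierstrassCurve Literature.NumberTheory.EllipticCurves
  Literature.NumberTheory.EllipticCurves.ModularForms Literature.NumberTheory.GaloisRepresentations
  Literature.NumberTheory.EllipticCurves.Rank1Residual Summit.BirchSwinnertonDyer.Rank1Residual.Supersingular
  Summit.BirchSwinnertonDyer.Rank1Residual.X4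

namespace Summit.BirchSwinnertonDyer.BirchSwinnertonDyer.Theorems.KuriharaRigidity

/-! ## §1 `Λ`-algebra: the two product identities along `0 → A → Q → X → B → 0` -/

section Algebra

variable {R : Type} [CommRing R]
variable {X B : Type} [AddCommGroup X] [Module R X] [AddCommGroup B] [Module R B]

/-- **Characteristic ideals along `0 → A → Q → X → B → 0`, product form** (Noetherian domain; `Q`, `B`
finitely generated torsion): with `Q'` the image of `Q → X`, `char Q = char A · char Q'` and
`char X = char Q' · char B` (`Module.charIdeal_eq_mul_of_exact` on the two short exact pieces) — the
sibling's `charIdeal_eq_of_fourTermExact` with the middle factor exposed, so that a principal `char X`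
can be cancelled ("The theorem follows from these sequences", proof of Kobayashi's Thm. 7.4).
[cite: Kobayashi2003, proof of Thm. 7.4 (p. 13)] [cite: NeukirchSchmidtWingberg2008, Ch. V §3] -/
theorem charIdeal_mul_eq_of_fourTermExact [IsNoetherianRing R] [IsDomain R]
    {A Q : Type} [AddCommGroup A] [Module R A] [AddCommGroup Q] [Module R Q]
    [Module.Finite R Q] [Module.Finite R B]
    (hQ : Module.IsTorsion R Q) (hB : Module.IsTorsion R B)
    (f : A →ₗ[R] Q) (g : Q →ₗ[R] X) (h : X →ₗ[R] B)
    (hf : Function.Injective f) (hfg : Function.Exact f g) (hgh : Function.Exact g h)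
    (hh : Function.Surjective h) :
    Module.charIdeal R Q = Module.charIdeal R A * Module.charIdeal R (LinearMap.range g) ∧
    Module.charIdeal R X = Module.charIdeal R (LinearMap.range g) * Module.charIdeal R B := by
  set Q' : Submodule R X := LinearMap.range g with hQ'def
  have h1 : Function.Exact f g.rangeRestrict := by
    rw [LinearMap.exact_iff, LinearMap.ker_rangeRestrict, hfg.linearMap_ker_eq]
  have h2 : Function.Exact Q'.subtype h := by
    rw [LinearMap.exact_iff, hgh.linearMap_ker_eq, Submodule.range_subtype]
  haveI : Module.Finite R X := Module.Finite.of_exact h2 hh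
  have hXt : Module.IsTorsion R X := by
    intro x
    obtain ⟨s, hs⟩ := @hB (h x)
    have hx : s.1 • x ∈ LinearMap.range g := by
      rw [← hgh.linearMap_ker_eq, LinearMap.mem_ker, map_smul]
      exact hs
    obtain ⟨q, hq⟩ := hx
    obtain ⟨t, ht⟩ := @hQ q
    refine ⟨t * s, ?_⟩
    rw [Submonoid.smul_def, Submonoid.coe_mul, mul_smul, ← hq, ← map_smul, ← Submonoid.smul_def, ht,
      map_zero]
  exact ⟨Module.charIdeal_eq_mul_of_exact hQ f g.rangeRestrict hf (LinearMap.surjective_rangeRestrict g) h1,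
    Module.charIdeal_eq_mul_of_exact hXt Q'.subtype h (Submodule.injective_subtype Q') hh h2⟩

/-- In a domain, `(x) = I · (q)` with `x ≠ 0` forces `q ≠ 0`. [folklore] -/
theorem ne_zero_of_span_singleton_eq_mul_span_singleton {x q : R} {I : Ideal R} (hx : x ≠ 0)
    (h : Ideal.span {x} = I * Ideal.span {q}) : q ≠ 0 := by
  rintro rfl
  have : x ∈ I * Ideal.span {(0 : R)} := h ▸ Ideal.mem_span_singleton_self x
  rw [Ideal.span_singleton_eq_bot.mpr rfl, Ideal.mul_bot] at this
  exact hx (Ideal.mem_bot.mp this)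

end Algebra

/-! ## §2 Kobayashi's Thm. 7.4 at `η = 1`, converse direction, in the kernel: the signed main conjecture of
sign `ε` gives Kato's main identity on every sign-`ε` package datum -/

section Frame

variable (W : WeierstrassCurve ℚ) [W.IsElliptic] [W.IsGloballyMinimal] (p : ℕ) [Fact p.Prime]
  [ContinuousSMul ℤ_[p] (W.tateModule p)] [Module.Free ℤ_[p] (W.tateModule p)]
  [Module.Finite ℤ_[p] (W.tateModule p)]

omit [W.IsGloballyMinimal] in
/-- **Data assembly for one frame, with the torsion of `X^ε` as a HYPOTHESIS** (the sibling's
`exists_fourTerm_data_of_signedColemanKato` took it from Kobayashi Thm. 1.2 and the period unit from the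
named fact; here `hDtor` and `ord_p ϖ = 0` are displayed, so no named fact enters): for a newform `f` of `W`
(any level), period ratio `ϖ` with `ord_p ϖ = 0`, a Pollack pair, a dual datum `D` of `Sel^ε` (torsion),
a pinned fine dual `Y` and a package datum `d` on a pinned `I`, at an odd good `p` with `a_p = 0` and `E[p]`
irreducible: `Y.X` is torsion and there is `G₁ ∈ Λ`, `G₁ ≠ 0`, with `ι G₁ = C(ϖ)·ι L^ε`, `char(Λ/col Z) = (G₁)`,
`Λ/col Z` torsion, and the exact `0 → I.H/d.Z → Λ/col Z → D.X → Y.X → 0`. Proof adapted verbatim from the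
sibling (§2 there). [cite: Kobayashi2003, proof of Thm. 7.4 (p. 13), Thm. 7.3 i) (7.21), Thm. 6.3 (p. 11), (3.4)–(3.6) (p. 7)]
[cite: Pollack2003, Cor. 5.11 and Prop. 6.18] -/
theorem fourTerm_data_of_signedColemanKato_of_isTorsion
    (hirr : W.HasIrreducibleModPGaloisRep p) {ε : ℤˣ}
    {κ : ZpExtension ℚ p} {γ : absoluteGaloisGroup ℚ}
    {N : ℕ} [NeZero N] {f : CuspForm (Gamma0 N) 2} (hf : IsNewformOf W f)
    {ϖ : ℚ} (hϖ : (ϖ : ℝ) * W.realPeriodRat = plusPeriod f) (hvϖ : padicValRat p ϖ = 0)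
    {Lplus Lminus : IwasawaAlgebra p} (hL : IsPollackPair f p Lplus Lminus)
    (D : Kobayashi2003.SignedSelmerDualData W κ γ ε) (hDtor : Module.IsTorsion (IwasawaAlgebra p) D.X)
    {I : Kato2004.IwasawaH1Data W p κ γ}
    (Y : W.FineSelmerDualData κ γ) (d : Kobayashi2003.SignedColemanKatoData W p f ϖ κ γ ε I) :
    Module.IsTorsion (IwasawaAlgebra p) Y.X ∧
    ∃ G₁ : IwasawaAlgebra p, G₁ ≠ 0 ∧
      iwasawaToPowerSeries p G₁ =
        PowerSeries.C ((ϖ : ℚ) : ℚ_[p]) * iwasawaToPowerSeries p (kobayashiL ε Lplus Lminus) ∧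
      Module.charIdeal (IwasawaAlgebra p) (IwasawaAlgebra p ⧸ (d.Z.map d.col : Ideal (IwasawaAlgebra p))) =
        Ideal.span {G₁} ∧
      Module.IsTorsion (IwasawaAlgebra p) (IwasawaAlgebra p ⧸ (d.Z.map d.col : Ideal (IwasawaAlgebra p))) ∧
      ∃ (i : (I.H ⧸ d.Z) →ₗ[IwasawaAlgebra p]
            (IwasawaAlgebra p ⧸ (d.Z.map d.col : Ideal (IwasawaAlgebra p))))
        (j' : (IwasawaAlgebra p ⧸ (d.Z.map d.col : Ideal (IwasawaAlgebra p))) →ₗ[IwasawaAlgebra p] D.X)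
        (k' : D.X →ₗ[IwasawaAlgebra p] Y.X),
        Function.Injective i ∧ Function.Exact i j' ∧ Function.Exact j' k' ∧ Function.Surjective k' := by
  -- Kobayashi's `L_p^ε` (non-zero, Pollack) and its Néron normalisation `G₁ = C(u)·L ∈ Λ`
  set L : IwasawaAlgebra p := kobayashiL ε Lplus Lminus with hLdef
  have hLsgn : Kobayashi2003.IsSignedPAdicLFunction f p ε L := hL.isSignedPAdicLFunction_kobayashiL ε
  have hL0 : L ≠ 0 := by
    rw [hLdef, kobayashiL]
    split_ifs
    · exact hL.2.1
    · exact hL.1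
  have hϖ0 : ϖ ≠ 0 := by
    rintro rfl
    rw [Rat.cast_zero, zero_mul] at hϖ
    exact (IsNewform0.plusPeriod_pos_holds hf.1 hf.coeffField_eq_bot).ne hϖ
  obtain ⟨u, hu⟩ := exists_units_coe_eq_ratCast hϖ0 hvϖ
  set G₁ : IwasawaAlgebra p := PowerSeries.C (u : ℤ_[p]) * L with hG₁def
  have hG₁ : iwasawaToPowerSeries p G₁ =
      PowerSeries.C (((ϖ : ℚ) : ℚ_[p])) * iwasawaToPowerSeries p L := by
    rw [hG₁def, map_mul, ← hu]
    congr 1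
    rw [PowerSeries.map_C]
    rfl
  have hCu : (PowerSeries.C (u : ℤ_[p]) : IwasawaAlgebra p) ≠ 0 := by
    rw [Ne, ← map_zero (PowerSeries.C (R := ℤ_[p])), (PowerSeries.C_injective).eq_iff]
    exact Units.ne_zero u
  have hG₁0 : G₁ ≠ 0 := mul_ne_zero hCu hL0
  -- `J = col(Z)`; `char(Λ/J) = (G₁)` from Thm. 6.3 on ideals at every height-one prime
  set J : Ideal (IwasawaAlgebra p) := d.Z.map d.col with hJdef
  have hloc : ∀ 𝔭 : PrimeSpectrum (IwasawaAlgebra p), 𝔭.asIdeal.height = 1 →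
      ∃ s : IwasawaAlgebra p, s ∉ 𝔭.asIdeal ∧ s * G₁ ∈ J ∧
        ∀ x ∈ J, s * x ∈ Ideal.span {G₁} := by
    intro 𝔭 h𝔭
    obtain ⟨s, hs𝔭, hsG, hsZ⟩ := d.image_zeta_localized hirr L G₁ hLsgn hG₁ 𝔭 h𝔭
    refine ⟨s, hs𝔭, hsG, fun x hx => ?_⟩
    obtain ⟨z, hz, rfl⟩ := Submodule.mem_map.mp hx
    exact hsZ z hz
  have hcharJ : Module.charIdeal (IwasawaAlgebra p) (IwasawaAlgebra p ⧸ J) = Ideal.span {G₁} := by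
    rw [← Module.charIdeal_quotient_span_singleton hG₁0]
    unfold Module.charIdeal
    refine finprod_mem_congr rfl fun 𝔭 h𝔭 => ?_
    obtain ⟨s, hs𝔭, hsG, hsJ⟩ := hloc 𝔭 h𝔭
    rw [lengthAt_quotient_eq_of_localized 𝔭 hs𝔭 (J₁ := J) (J₂ := Ideal.span {G₁}) ?_ hsJ]
    intro x hx
    obtain ⟨r, rfl⟩ := Ideal.mem_span_singleton'.mp hx
    rw [← mul_assoc, mul_comm s r, mul_assoc]
    exact J.mul_mem_left r hsG
  -- `Λ/J` is torsion: `J ∋ s₀·G₁ ≠ 0` at the height-one prime `(p)`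
  let 𝔭₀ : PrimeSpectrum (IwasawaAlgebra p) :=
    ⟨IwasawaAlgebra.augIdealP p, IwasawaAlgebra.isPrime_augIdealP_holds p⟩
  obtain ⟨s₀, hs₀, hs₀G, -⟩ := hloc 𝔭₀ (by exact IwasawaAlgebra.height_augIdealP_holds p)
  have hs₀0 : s₀ ≠ 0 := by
    rintro rfl
    exact hs₀ (zero_mem _)
  have hQtor : Module.IsTorsion (IwasawaAlgebra p) (IwasawaAlgebra p ⧸ J) :=
    isTorsion_quotient_of_mem hs₀G (mul_ne_zero hs₀0 hG₁0)
  -- (7.21) for `D`, `Y`, and the four-term sequence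
  obtain ⟨j, k, hcj, hjk, hk⟩ := d.exact D Y
  obtain ⟨i, j', k', hi, hij, hjk', hk'⟩ :=
    exists_fourTermExact_of_threeTermExact_submodule d.col j k d.col_injective hcj hjk hk d.Z
  exact ⟨isTorsion_of_surjective hDtor k' hk', G₁, hG₁0, hG₁, hcharJ, hQtor, i, j', k', hi, hij, hjk', hk'⟩

/-- **Kobayashi 2003 Thm. 7.4, «the signed main conjecture of sign `ε` ⟹ Kato's main conjecture», AT
`η = 1`, IN THE KERNEL.** `W/ℚ` globally minimal, `p` an ODD good prime with `a_p = 0`, `E[p]` irreducible;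
a frame of the tree's `KobayashiMainConjecture W p ε` (cyclotomic `(κ, γ)` matching the variable, the
newform `f` at level `N_E`, the period ratio `ϖ` — here with `ord_p ϖ = 0` displayed — and a Pollack pair);
then for ALL pinned `I` (`𝐇¹(T)^Δ`), `Y` (`X⁰(E/K_∞)^Δ ≅ 𝐇²(T)^Δ`) and EVERY sign-`ε` package datum `d`
(Thm. 6.2/6.3/7.3 i) + Kato 12.6): `char_Λ(Y.X) = char_Λ(I.H ⧸ d.Z)` («`Char 𝐇²(T) = Char 𝐇¹(T)/Z(T)`»,
§5 p. 10). Proof: a dual datum `D` of `Sel^ε` exists (`nonempty_signedSelmerDualData`); the conjecture gives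
`X^ε = D.X` torsion with `char X^ε = (G)`, `ι G = C(ϖ)·ι L^ε = ι G₁`, so `G = G₁` (`ι` injective); along the
four-term sequence `char(𝐇¹/Z)·char Q' = char(Λ/col Z) = (G₁) = char X^ε = char Q'·char X₀`, and the
principal non-zero `char Q'` cancels. CONDITIONAL on the displayed `hMC`; closes nothing.
[cite: Kobayashi2003, Thm. 7.4 and its proof (p. 13), §5 (p. 10), §4 (p. 8)]
[cite: Kato2004Asterisque, Conj. 12.10 (p. 224)] [cite: NeukirchSchmidtWingberg2008, Ch. V §3] -/
theorem katoMainIdentity_of_kobayashiMainConjecture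
    (hirr : W.HasIrreducibleModPGaloisRep p) {ε : ℤˣ} (hMC : KobayashiMainConjecture W p ε)
    {κ : ZpExtension ℚ p} {γ : absoluteGaloisGroup ℚ} (hκ : κ.IsCyclotomic) (hγ : κ.IsTopGenerator γ)
    (hγc : IsCyclotomicVariable p γ) [NeZero (W.conductorNorm ℤ)]
    {f : CuspForm (Gamma0 (W.conductorNorm ℤ)) 2} (hf : IsNewformOf W f)
    {ϖ : ℚ} (hϖ : (ϖ : ℝ) * W.realPeriodRat = plusPeriod f) (hvϖ : padicValRat p ϖ = 0)
    {Lplus Lminus : IwasawaAlgebra p} (hL : IsPollackPair f p Lplus Lminus)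
    (I : Kato2004.IwasawaH1Data W p κ γ) (Y : W.FineSelmerDualData κ γ)
    (d : Kobayashi2003.SignedColemanKatoData W p f ϖ κ γ ε I) :
    Module.charIdeal (IwasawaAlgebra p) Y.X = Module.charIdeal (IwasawaAlgebra p) (I.H ⧸ d.Z) := by
  -- a dual datum of `Sel^ε(E/ℚ_∞)`, and what the signed main conjecture says about it
  obtain ⟨D⟩ := Kobayashi2003.nonempty_signedSelmerDualData W κ ε hγ
  haveI : Module.Finite (IwasawaAlgebra p) Y.X :=
    WeierstrassCurve.FineSelmerDualData.module_finite _ κ hγ Y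
  obtain ⟨hDtor, G, hcharD, hιG⟩ := hMC κ γ hκ hγ hγc f hf ϖ hϖ Lplus Lminus hL D
  have hcharD' : Module.charIdeal (IwasawaAlgebra p) D.X = Ideal.span {G} := hcharD
  -- the four-term data
  obtain ⟨hYtor, G₁, hG₁0, hG₁, hcharJ, hQtor, i, j', k', hi, hij, hjk', hk'⟩ :=
    fourTerm_data_of_signedColemanKato_of_isTorsion W p hirr hf hϖ hvϖ hL D hDtor Y d
  -- `G = G₁`
  have hGG : G = G₁ := iwasawaToPowerSeries_injective p (hιG.trans hG₁.symm)
  have hX : Module.charIdeal (IwasawaAlgebra p) D.X = Ideal.span {G₁} := hGG ▸ hcharD'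
  -- the two product identities, and cancellation of the principal non-zero `char Q'`
  obtain ⟨e1, e2⟩ := charIdeal_mul_eq_of_fourTermExact hQtor hYtor i j' k' hi hij hjk' hk'
  obtain ⟨q, hq⟩ := (charIdeal_isPrincipal_holds p (LinearMap.range j')).principal
  have hq' : Module.charIdeal (IwasawaAlgebra p) (LinearMap.range j') = Ideal.span {q} := hq
  rw [hcharJ, hq', mul_comm] at e1
  rw [hX, hq'] at e2
  have hq0 : q ≠ 0 := ne_zero_of_span_singleton_eq_mul_span_singleton hG₁0 (e1.trans (mul_comm _ _))
  exact (Ideal.span_singleton_mul_right_inj hq0).mp (e2.symm.trans e1)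

end Frame

/-! ## §3 The lead's converse binder `Kobayashi74_CastellaSano2026_kimTamagawaDefect_of_signedMC_OPEN` DERIVED
from Castella–Sano Thm. 1 (ii) ⟹ (i) on the package (displayed frame) + §2 + three published facts by name -/

/-- **`Kobayashi74_CastellaSano2026_kimTamagawaDefect_of_signedMC_OPEN` DERIVED.** Displayed hypothesis `hCSc`
= VERBATIM the body of the Literature statement `CastellaSano2026.thm1_kimTamagawaDefect_of_katoMainIdentity_OPEN`
(Castella–Sano arXiv:2601.14504, PREPRINT, Thm. 1 (ii) ⟹ (i) for `E := W` non-CM at a good `p ≥ 5` with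
`a_p = 0`, `ρ̄` onto, (manin) as the period transfer: Kato's main identity read on the sign-`ε` `η = 1` package
⟹ Kim's Tamagawa-defect identity `∂^{(∞)}(δ̃) = ord_p Tam_E` over cyclic levels — NEVER a theorem); by name:
the package construction fact `hPkg : Kobayashi2003.thm62_63_73_signedColemanKato_zeta` (Kobayashi Thm.
6.2/6.3/7.3 i) + Kato 12.6, PUBLISHED), Pollack's theorem `hPollack` (PUBLISHED) and modularity
`hmod : exists_isNewformOf` (PUBLISHED; pins the level of the binder's newform to `N_E` by Atkin–Lehner strong
multiplicity one). CONCLUSION: the lead's composite binder. Proof: unfold; `ϖ = u⁻¹` from the period transfer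
(`|u|_p = 1`, so `ord_p ϖ = 0`); the cyclotomic pair from
`exists_isCyclotomic_isTopGenerator_isCyclotomicVariable_holds`; then `hCSc` on the frame, whose Kato identity
is `katoMainIdentity_of_kobayashiMainConjecture` (§2) at the package datum supplied by `hPkg`. CONDITIONAL on
`hCSc` (a PREPRINT claim), `hPkg`, `hPollack`, `hmod`; closes nothing. [claim: CastellaSano2026, status: under-review]
[cite: Kobayashi2003, Thm. 7.4 (p. 13), Thm. 6.2–6.3 (p. 11), Thm. 7.3 i) (p. 13)]
[cite: Pollack2003, Thm. 5.6, Cor. 5.11 and Prop. 6.18] [cite: AtkinLehner1970, Thm. 4] -/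
theorem kobayashi74_castellaSano2026_kimTamagawaDefect_of_signedMC_OPEN_of_katoFrame
    (hCSc : ∀ (W : WeierstrassCurve ℚ) [W.IsElliptic] [W.IsGloballyMinimal] (p : ℕ) [Fact p.Prime]
        [ContinuousSMul ℤ_[p] (W.tateModule p)] [Module.Free ℤ_[p] (W.tateModule p)]
        [Module.Finite ℤ_[p] (W.tateModule p)]
        {N : ℕ} [NeZero N] (f : CuspForm (Gamma0 N) 2) (ϖ : ℚ)
        (κ : ZpExtension ℚ p) (γ : absoluteGaloisGroup ℚ) (ε : ℤˣ),
        5 ≤ p → W.HasGoodReductionAtPrime p → W.frobeniusTrace p = 0 → IsNewformOf W f →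
        (ϖ : ℝ) * W.realPeriodRat = plusPeriod f →
        κ.IsCyclotomic → κ.IsTopGenerator γ → IsCyclotomicVariable p γ →
        ¬ W.HasCM → W.HasSurjectiveModNGaloisRep p →
        (∃ u : ℚ, ‖(u : ℚ_[p])‖ = 1 ∧ W.realPeriodRat = u * plusPeriod f) →
        (∀ (I : Kato2004.IwasawaH1Data W p κ γ) (Y : W.FineSelmerDualData κ γ),
          ∃ d : Kobayashi2003.SignedColemanKatoData W p f ϖ κ γ ε I,
            Module.charIdeal (IwasawaAlgebra p) Y.X =
              Module.charIdeal (IwasawaAlgebra p) (I.H ⧸ d.Z)) →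
        kuriharaPartialInfty W p f = (padicValNat p W.tamagawaProduct : ℕ∞))
    (hPkg : Kobayashi2003.thm62_63_73_signedColemanKato_zeta)
    (hPollack : ∀ (W : WeierstrassCurve ℚ) [W.IsElliptic] [W.IsGloballyMinimal] {N : ℕ} [NeZero N]
        (f : CuspForm (Gamma0 N) 2) (p : ℕ) [Fact p.Prime],
        pollack_exists_plusMinusPAdicLFunction (W := W) (f := f) (p := p))
    (hmod : exists_isNewformOf) :
    Kobayashi74_CastellaSano2026_kimTamagawaDefect_of_signedMC_OPEN := by
  intro W _ _ p _ hp5 hgood hap hcm hs N _ f hf hper hMC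
  obtain ⟨ε, hMC⟩ := hMC
  have hpP : p.Prime := Fact.out
  have hp2 : p ≠ 2 := by omega
  haveI : ContinuousSMul ℤ_[p] (W.tateModule p) := TateModule.continuousSMul_padicInt
  haveI : Module.Free ℤ_[p] (W.tateModule p) := W.module_free_tateModule_holds p
  haveI : Module.Finite ℤ_[p] (W.tateModule p) := W.module_finite_tateModule_holds p
  have hirr : W.HasIrreducibleModPGaloisRep p :=
    hasIrreducibleModPGaloisRep_of_hasSurjectiveModNGaloisRep W p hs
  -- the binder's newform lives at level `N_E` (modularity + strong multiplicity one)
  haveI : NeZero (W.conductorNorm ℤ) := ⟨(WeierstrassCurve.conductorNorm_pos_holds W).ne'⟩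
  obtain ⟨g, hg⟩ := hmod W
  have hN : N = W.conductorNorm ℤ := hf.level_eq_level hg
  subst hN
  -- the period ratio `ϖ = u⁻¹`, a `p`-adic unit
  obtain ⟨u, hu1, hu⟩ := hper
  have hu0 : u ≠ 0 := by
    rintro rfl
    simp at hu1
  have hϖ : ((u⁻¹ : ℚ) : ℝ) * W.realPeriodRat = plusPeriod f := by
    rw [hu, Rat.cast_inv, ← mul_assoc, inv_mul_cancel₀ (by exact_mod_cast hu0), one_mul]
  have hvϖ : padicValRat p (u⁻¹ : ℚ) = 0 := by
    rw [padicValRat.inv, padicValRat_eq_zero_of_norm_ratCast_eq_one hu1, neg_zero]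
  -- the cyclotomic pair matching the variable, and a Pollack pair
  obtain ⟨κ, hκ, γ, hγ, hγc⟩ := exists_isCyclotomic_isTopGenerator_isCyclotomicVariable_holds p
  obtain ⟨Lplus, Lminus, hL⟩ := exists_isPollackPair (hPollack W f p) hp2 hf hgood hap
  -- Castella–Sano (ii) ⟹ (i) on the sign-`ε` package, fed by §2
  change kuriharaPartialInfty W p f = (padicValNat p W.tamagawaProduct : ℕ∞)
  refine hCSc W p f (u⁻¹ : ℚ) κ γ ε hp5 hgood hap hf hϖ hκ hγ hγc hcm hs ⟨u, hu1, hu⟩ ?_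
  intro I Y
  obtain ⟨d⟩ := hPkg W p f (u⁻¹ : ℚ) κ γ hp2 hgood hap hf hϖ hκ hγ hγc ε I
  exact ⟨d, katoMainIdentity_of_kobayashiMainConjecture W p hirr hMC hκ hγ hγc hf hϖ hvϖ hL I Y d⟩

end Summit.BirchSwinnertonDyer.BirchSwinnertonDyer.Theorems.KuriharaRigidity

end
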